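import Mathlib
import HarnessLib
import Literature.MathematicalPhysics.KineticTheory.VelocityFlipNoise
import Literature.MathematicalPhysics.KineticTheory.LangevinChainNESSProofs
import Literature.MathematicalPhysics.KineticTheory.LangevinChainLyapunov
import Literature.Probability.Process.KrylovBogoliubov

import Summits.AtomisticToContinuum.FouriersLaw.Theorems.VanishingNoiseTransferVanishingNoiseBoundFlipWeakLimitGrowth

/-!
# The unique flip-steady family is weakly continuous at `δ = 0`

`--supports stmt-AtomisticToContinuum-11976` helper file (crux `VanishingNoiseBound`, route
`VanishingNoiseTransfer`, line `fekete-usc-one-length`, stub S3 `stub_noisyPositiveConductance`, wave 3).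
For the pinned chain `pinnedChain ω₂ lam β γ` (all parameters `> 0`), a flip rate `ε` (any real), a flip-steady
family `μ` unique in `IsFlipSteadyState`, `T > 0`, `N ≥ 2`, GIVEN uniform exponential moments
`∫ e^{H/(2T)} dμ_{N,T+δ/2,T−δ/2} ≤ M` for `|δ| ≤ T` (the landed `flip_uniform_exp_moment`, `…FlipUniformMoments`,
for `ε > 0`):

* `flip_tendsto_integral` — `μ_{N,T+δ/2,T−δ/2} ⇒ μ_{N,T,T}` weakly as `δ → 0`, `δ ≠ 0` (convergence of `∫ g dμ_δ`
  for every bounded continuous `g`). Proof = the flip twin of `LinearResponseFTUR.ness_tendsto_integral` (crux 9122,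
  Helper 4): tightness (Markov) and Prokhorov; every subsequential limit is a probability measure solving the weak
  FLIP-stationary equation at `(T, T)` (the flip generator `L_{a,b} + εS` is AFFINE in the bath temperatures with
  the flip part temperature independent, and `(L + εS) f` is bounded continuous for `f ∈ C_c^∞`) whose bond
  currents are integrable (Fatou for `e^{ϑH}`), hence equals `μ_{N,T,T}` by uniqueness; a unique limit point in a
  compact set forces convergence.
* `flip_tendsto_integral_of_growth` — the same for continuous `|g| ≤ C e^{ϑ'H}`, `0 ≤ ϑ' < 1/(2T)` (the abstract
  energy-truncation lemma `tendsto_integral_of_dominated_growth`, `…FlipWeakLimitGrowth`).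
* `helper_flipNessTendstoIntegral` — registered helper (notation-free restatement).

References: Bonetto–Lebowitz–Rey-Bellet 2000 §5; Bernardin–Olla 2011 §2.1; folklore (Prokhorov).
-/

noncomputable section

open MeasureTheory ProbabilityTheory Filter Topology Set
open scoped NNReal ENNReal Topology ContDiff BoundedContinuousFunction
open Literature.MathematicalPhysics.KineticTheory.HeatConduction Literature.Probability.Process OscillatorChain

namespace Summit.AtomisticToContinuum.FouriersLaw.Theorems.VanishingNoiseBound

/-- The generator of an oscillator chain is affine in the bath temperatures:
`L_{a,b} = L_{0,0} + a (L_{1,0} - L_{0,0}) + b (L_{0,1} - L_{0,0})` (copy of the private `generator_affine` of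
`…LinearResponseFTURBondHeatVarianceContinuityHelper4`). [folklore] -/
theorem generator_affine' (P : OscillatorChain) (N : ℕ) (a b : ℝ) (f : PhaseSpace N → ℝ)
    (x : PhaseSpace N) :
    P.generator N a b f x = P.generator N 0 0 f x + a * (P.generator N 1 0 f x - P.generator N 0 0 f x) +
      b * (P.generator N 0 1 f x - P.generator N 0 0 f x) := by
  unfold OscillatorChain.generator
  have key : ∀ i ∈ (Finset.univ : Finset (Fin N)),
      ((if i.val = 0 then a * partialP i (partialP i f) x - x.2 i * partialP i f x else 0) +
        (if i.val = N - 1 then b * partialP i (partialP i f) x - x.2 i * partialP i f x else 0)) =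
      ((if i.val = 0 then 0 * partialP i (partialP i f) x - x.2 i * partialP i f x else 0) +
        (if i.val = N - 1 then 0 * partialP i (partialP i f) x - x.2 i * partialP i f x else 0)) +
      a * (((if i.val = 0 then 1 * partialP i (partialP i f) x - x.2 i * partialP i f x else 0) +
        (if i.val = N - 1 then 0 * partialP i (partialP i f) x - x.2 i * partialP i f x else 0)) -
        ((if i.val = 0 then 0 * partialP i (partialP i f) x - x.2 i * partialP i f x else 0) +
        (if i.val = N - 1 then 0 * partialP i (partialP i f) x - x.2 i * partialP i f x else 0))) +
      b * (((if i.val = 0 then 0 * partialP i (partialP i f) x - x.2 i * partialP i f x else 0) +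
        (if i.val = N - 1 then 1 * partialP i (partialP i f) x - x.2 i * partialP i f x else 0)) -
        ((if i.val = 0 then 0 * partialP i (partialP i f) x - x.2 i * partialP i f x else 0) +
        (if i.val = N - 1 then 0 * partialP i (partialP i f) x - x.2 i * partialP i f x else 0))) := by
    intro i _
    split_ifs <;> ring
  rw [Finset.sum_congr rfl key]
  simp only [Finset.sum_add_distrib, Finset.sum_sub_distrib, ← Finset.mul_sum]
  ring

/-- The flip generator is affine in the bath temperatures (the flip part does not see them):
`(L_{a,b} + εS) = (L_{0,0} + εS) + a (L_{1,0} - L_{0,0}) + b (L_{0,1} - L_{0,0})`. [folklore] -/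
theorem flipGenerator_affine (P : OscillatorChain) (N : ℕ) (a b ε : ℝ) (f : PhaseSpace N → ℝ)
    (x : PhaseSpace N) :
    P.flipGenerator N a b ε f x = P.flipGenerator N 0 0 ε f x +
      a * (P.generator N 1 0 f x - P.generator N 0 0 f x) + b * (P.generator N 0 1 f x - P.generator N 0 0 f x) := by
  rw [P.flipGenerator_eq_add_flipNoise, P.flipGenerator_eq_add_flipNoise, generator_affine' P N a b f x]
  ring

section Weak

variable {ω₂ lam β γ : ℝ}

/-- **Weak continuity of the unique flip-steady family at `δ = 0`** (bounded continuous observables), GIVEN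
uniform exponential moments on `|δ| ≤ T`. See the module docstring. [folklore] -/
theorem flip_tendsto_integral (hω : 0 < ω₂) (hl : 0 < lam) (hβ : 0 < β) (ε : ℝ)
    (μ : (N : ℕ) → ℝ → ℝ → Measure (PhaseSpace N))
    (hμ : ∀ (N : ℕ) (T_L T_R : ℝ), 0 < T_L → 0 < T_R →
      (pinnedChain ω₂ lam β γ).IsFlipSteadyState N T_L T_R ε (μ N T_L T_R) ∧
        ∀ ν : Measure (PhaseSpace N), (pinnedChain ω₂ lam β γ).IsFlipSteadyState N T_L T_R ε ν → ν = μ N T_L T_R)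
    {T : ℝ} (hT : 0 < T) {N : ℕ} {M : ℝ}
    (hM : ∀ δ : ℝ, |δ| ≤ T →
      Integrable (fun x => Real.exp (1 / (2 * T) * (pinnedChain ω₂ lam β γ).hamiltonian N x))
          (μ N (T + δ / 2) (T - δ / 2)) ∧
        ∫ x, Real.exp (1 / (2 * T) * (pinnedChain ω₂ lam β γ).hamiltonian N x) ∂(μ N (T + δ / 2) (T - δ / 2)) ≤ M)
    {g : PhaseSpace N → ℝ} (hg : Continuous g) {C : ℝ} (hgC : ∀ x, |g x| ≤ C) :
    Tendsto (fun δ : ℝ => ∫ x, g x ∂(μ N (T + δ / 2) (T - δ / 2))) (𝓝[≠] 0)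
      (𝓝 (∫ x, g x ∂(μ N T T))) := by
  -- adapted from `LinearResponseFTUR.ness_tendsto_integral` (…BondHeatVarianceContinuityHelper4, crux 9122)
  set P := pinnedChain ω₂ lam β γ with hP
  set ϑ : ℝ := 1 / (2 * T) with hϑ
  have hϑ0 : 0 < ϑ := by positivity
  set V : PhaseSpace N → ℝ := fun x => Real.exp (ϑ * P.hamiltonian N x) with hV
  have hVc : Continuous V :=
    Real.continuous_exp.comp (continuous_const.mul (pinnedChain_continuous_hamiltonian ω₂ lam β γ N))
  -- positivity of the temperatures on the box
  have hpos : ∀ δ : ℝ, |δ| ≤ T → 0 < T + δ / 2 ∧ 0 < T - δ / 2 := fun δ hδ => by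
    have h := abs_le.1 hδ
    exact ⟨by linarith only [hT, h.1], by linarith only [hT, h.2]⟩
  have hprob : ∀ δ : ℝ, |δ| ≤ T → IsProbabilityMeasure (μ N (T + δ / 2) (T - δ / 2)) := fun δ hδ =>
    (hμ N _ _ (hpos δ hδ).1 (hpos δ hδ).2).1.isProbabilityMeasure
  have hprob0 : IsProbabilityMeasure (μ N T T) := (hμ N T T hT hT).1.isProbabilityMeasure
  -- the family as probability measures
  let pm : ℝ → ProbabilityMeasure (PhaseSpace N) := fun δ =>
    if h : |δ| ≤ T then ⟨μ N (T + δ / 2) (T - δ / 2), hprob δ h⟩ else ⟨μ N T T, hprob0⟩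
  have hpm : ∀ δ : ℝ, |δ| ≤ T →
      ((pm δ : ProbabilityMeasure (PhaseSpace N)) : Measure (PhaseSpace N)) = μ N (T + δ / 2) (T - δ / 2) := by
    intro δ hδ
    simp only [pm, dif_pos hδ]
    rfl
  -- tightness of the family (Markov's inequality with the uniform exponential moments) and Prokhorov
  set S : Set (ProbabilityMeasure (PhaseSpace N)) := {ν | ∃ δ : ℝ, |δ| ≤ T ∧ ν = pm δ} with hS
  have htight : IsTightMeasureSet
      {x | ∃ ν ∈ S, ((ν : ProbabilityMeasure (PhaseSpace N)) : Measure (PhaseSpace N)) = x} := by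
    refine Literature.Probability.Process.MarkovSemigroup.isTightMeasureSet_of_lintegral_le
      (V := fun x => (V x).toNNReal) (continuous_real_toNNReal.comp hVc)
      (fun R => pinnedChain_isCompact_setOf_exp_le hω hl.le hβ.le γ N hϑ0 R) (C := ENNReal.ofReal M)
      ENNReal.ofReal_ne_top ?_
    rintro _ ⟨ν, ⟨δ, hδ, rfl⟩, rfl⟩
    rw [hpm δ hδ]
    obtain ⟨hint, hle⟩ := hM δ hδ
    have h1 : ∫⁻ x, ((V x).toNNReal : ℝ≥0∞) ∂(μ N (T + δ / 2) (T - δ / 2)) =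
        ENNReal.ofReal (∫ x, V x ∂(μ N (T + δ / 2) (T - δ / 2))) := by
      rw [ofReal_integral_eq_lintegral_ofReal hint (Eventually.of_forall fun x => (Real.exp_pos _).le)]
      rfl
    rw [h1]
    exact ENNReal.ofReal_le_ofReal hle
  have hcomp := isCompact_closure_of_isTightMeasureSet htight
  ----------------------------------------------------------------
  -- identification of the subsequential limits: weak flip steady states at `(T, T)`, hence `μ N T T`
  ----------------------------------------------------------------
  have hident : ∀ s : ℕ → ℝ, Tendsto s atTop (𝓝 0) → ∀ ν : ProbabilityMeasure (PhaseSpace N),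
      Tendsto (fun n => pm (s n)) atTop (𝓝 ν) →
      ((ν : ProbabilityMeasure (PhaseSpace N)) : Measure (PhaseSpace N)) = μ N T T := by
    intro s hs ν hlim
    have hsT : ∀ᶠ n in atTop, |s n| ≤ T := by
      have h : ∀ᶠ δ : ℝ in 𝓝 0, |δ| ≤ T := by
        have : Metric.closedBall (0 : ℝ) T ∈ 𝓝 (0 : ℝ) := Metric.closedBall_mem_nhds 0 hT
        filter_upwards [this] with δ hδ
        simpa [Real.dist_eq] using hδ
      exact hs.eventually h
    -- (2) the weak flip-stationary equation at `(T, T)`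
    have hgen : ∀ f : PhaseSpace N → ℝ, ContDiff ℝ (⊤ : ℕ∞) f → HasCompactSupport f →
        ∫ x, P.flipGenerator N T T ε f x ∂(ν : Measure (PhaseSpace N)) = 0 := by
      intro f hf hfc
      have hf2 : ContDiff ℝ 2 f := hf.of_le (by norm_cast)
      have hU1 := pinnedChain_contDiff_U ω₂ lam β γ (n := 1)
      have hV1 := pinnedChain_contDiff_V ω₂ lam β γ (n := 1)
      have hLc : ∀ a b : ℝ, Continuous (P.generator N a b f) := fun a b =>
        P.continuous_generator hU1 hV1 N a b hf2
      have hLb : ∀ a b : ℝ, ∃ Cab : ℝ, ∀ x, ‖P.generator N a b f x‖ ≤ Cab := fun a b =>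
        P.exists_bound_generator hU1 hV1 N a b hf2 hfc
      obtain ⟨C00, hC00⟩ := hLb 0 0
      obtain ⟨C10, hC10⟩ := hLb 1 0
      obtain ⟨C01, hC01⟩ := hLb 0 1
      obtain ⟨CTT, hCTT⟩ := hLb T T
      -- the flip part: continuous and bounded
      obtain ⟨Cf, hCf⟩ : ∃ C, ∀ x, ‖f x‖ ≤ C := hf.continuous.bounded_above_of_compact_support hfc
      have hSc : Continuous (flipNoise N f) := by
        have h : flipNoise N f = fun x => ∑ i, (f (momentumFlip i x) - f x) := funext fun x => flipNoise_eq N f x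
        rw [h]
        exact continuous_finsetSum _ fun i _ => (hf.continuous.comp (continuous_momentumFlip i)).sub hf.continuous
      have hSb : ∀ x, ‖flipNoise N f x‖ ≤ N * (Cf + Cf) := by
        intro x
        rw [flipNoise_eq]
        calc ‖∑ i : Fin N, (f (momentumFlip i x) - f x)‖ ≤ ∑ i : Fin N, ‖f (momentumFlip i x) - f x‖ :=
              norm_sum_le _ _
          _ ≤ ∑ _i : Fin N, (Cf + Cf) := Finset.sum_le_sum fun i _ =>
              (norm_sub_le _ _).trans (add_le_add (hCf _) (hCf _))
          _ = N * (Cf + Cf) := by simp [Finset.sum_const, Finset.card_univ, Fintype.card_fin]; ring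
      have hFc : Continuous (P.flipGenerator N T T ε f) := by
        have h : P.flipGenerator N T T ε f = fun x => P.generator N T T f x + ε * flipNoise N f x :=
          funext fun x => P.flipGenerator_eq_add_flipNoise N T T ε f x
        rw [h]; exact (hLc T T).add (continuous_const.mul hSc)
      have hFb : ∀ x, ‖P.flipGenerator N T T ε f x‖ ≤ CTT + |ε| * (N * (Cf + Cf)) := by
        intro x
        rw [P.flipGenerator_eq_add_flipNoise]
        refine (norm_add_le _ _).trans (add_le_add (hCTT x) ?_)
        rw [norm_mul, Real.norm_eq_abs]
        exact mul_le_mul_of_nonneg_left (hSb x) (abs_nonneg _)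
      set A : PhaseSpace N → ℝ := fun x => P.generator N 1 0 f x - P.generator N 0 0 f x with hA
      set B : PhaseSpace N → ℝ := fun x => P.generator N 0 1 f x - P.generator N 0 0 f x with hB
      have hAc : Continuous A := (hLc 1 0).sub (hLc 0 0)
      have hBc : Continuous B := (hLc 0 1).sub (hLc 0 0)
      have hAb : ∀ x, ‖A x‖ ≤ C10 + C00 := fun x => (norm_sub_le _ _).trans (add_le_add (hC10 x) (hC00 x))
      have hBb : ∀ x, ‖B x‖ ≤ C01 + C00 := fun x => (norm_sub_le _ _).trans (add_le_add (hC01 x) (hC00 x))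
      -- along the sequence: `∫ (L_{T,T} + εS) f dμ_{s_n} = -(s_n/2) (∫ A - ∫ B)`
      have hseq : ∀ n, |s n| ≤ T → ∫ x, P.flipGenerator N T T ε f x ∂(pm (s n) : Measure (PhaseSpace N)) =
          -(s n / 2) * ((∫ x, A x ∂(μ N (T + s n / 2) (T - s n / 2))) -
            ∫ x, B x ∂(μ N (T + s n / 2) (T - s n / 2))) := by
        intro n hn
        rw [hpm _ hn]
        set ρ := μ N (T + s n / 2) (T - s n / 2) with hρ
        haveI : IsProbabilityMeasure ρ := hprob _ hn
        have hss := (hμ N _ _ (hpos _ hn).1 (hpos _ hn).2).1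
        have h0 : ∫ x, P.flipGenerator N (T + s n / 2) (T - s n / 2) ε f x ∂ρ = 0 := hss.2.1 f hf hfc
        have hintL : ∀ a b : ℝ, Integrable (P.generator N a b f) ρ := fun a b =>
          P.integrable_generator hU1 hV1 N a b hf2 hfc ρ
        have hintF : ∀ a b : ℝ, Integrable (P.flipGenerator N a b ε f) ρ := by
          intro a b
          have h : P.flipGenerator N a b ε f = fun x => P.generator N a b f x + ε * flipNoise N f x :=
            funext fun x => P.flipGenerator_eq_add_flipNoise N a b ε f x
          rw [h]
          refine (hintL a b).add (Integrable.const_mul ?_ ε)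
          exact (integrable_const (N * (Cf + Cf))).mono' hSc.aestronglyMeasurable (Eventually.of_forall hSb)
        have hintA : Integrable A ρ := (hintL 1 0).sub (hintL 0 0)
        have hintB : Integrable B ρ := (hintL 0 1).sub (hintL 0 0)
        have hpt : ∀ x, P.flipGenerator N T T ε f x =
            P.flipGenerator N (T + s n / 2) (T - s n / 2) ε f x + (-(s n / 2)) * A x + (s n / 2) * B x := by
          intro x
          rw [flipGenerator_affine P N T T ε f x, flipGenerator_affine P N (T + s n / 2) (T - s n / 2) ε f x]
          simp only [hA, hB]
          ring
        simp_rw [hpt]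
        have hI1 : Integrable (fun x => P.flipGenerator N (T + s n / 2) (T - s n / 2) ε f x + -(s n / 2) * A x) ρ :=
          (hintF _ _).add (hintA.const_mul _)
        have hI2 : Integrable (fun x => s n / 2 * B x) ρ := hintB.const_mul _
        have hI3 : Integrable (fun x => -(s n / 2) * A x) ρ := hintA.const_mul _
        rw [integral_add hI1 hI2, integral_add (hintF _ _) hI3, integral_const_mul, integral_const_mul, h0]
        ring
      have hto0 : Tendsto (fun n => ∫ x, P.flipGenerator N T T ε f x ∂(pm (s n) : Measure (PhaseSpace N)))
          atTop (𝓝 0) := by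
        have hbound : ∀ᶠ n in atTop, ‖∫ x, P.flipGenerator N T T ε f x ∂(pm (s n) : Measure (PhaseSpace N))‖ ≤
            |s n| / 2 * ((C10 + C00) + (C01 + C00)) := by
          filter_upwards [hsT] with n hn
          rw [hseq n hn]
          set ρ := μ N (T + s n / 2) (T - s n / 2) with hρ
          haveI : IsProbabilityMeasure ρ := hprob _ hn
          have h1 : ‖∫ x, A x ∂ρ‖ ≤ C10 + C00 := by
            refine (norm_integral_le_of_norm_le_const (Eventually.of_forall hAb)).trans ?_
            simp
          have h2 : ‖∫ x, B x ∂ρ‖ ≤ C01 + C00 := by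
            refine (norm_integral_le_of_norm_le_const (Eventually.of_forall hBb)).trans ?_
            simp
          rw [norm_mul, norm_neg, Real.norm_eq_abs, abs_div, abs_two]
          refine mul_le_mul_of_nonneg_left ((norm_sub_le _ _).trans (add_le_add h1 h2)) (by positivity)
        refine squeeze_zero_norm' hbound ?_
        have h : Tendsto (fun n => |s n| / 2 * ((C10 + C00) + (C01 + C00))) atTop
            (𝓝 (|0| / 2 * ((C10 + C00) + (C01 + C00)))) :=
          ((continuous_abs.tendsto 0).comp hs |>.div_const 2).mul_const _
        simpa using h
      -- weak convergence tested on the bounded continuous function `(L_{T,T} + εS) f`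
      let Lb : PhaseSpace N →ᵇ ℝ := BoundedContinuousFunction.ofNormedAddCommGroup
        (P.flipGenerator N T T ε f) hFc (CTT + |ε| * (N * (Cf + Cf))) hFb
      have hwk := (ProbabilityMeasure.tendsto_iff_forall_integral_tendsto.1 hlim) Lb
      exact tendsto_nhds_unique hwk hto0
    -- (3) the bond currents are integrable under the limit (Fatou for `e^{ϑH}`)
    have hintV : Integrable V (ν : Measure (PhaseSpace N)) := by
      have hopen : ∀ G, IsOpen G → (ν : Measure (PhaseSpace N)) G ≤
          atTop.liminf (fun n => ((pm (s n) : ProbabilityMeasure (PhaseSpace N)) : Measure (PhaseSpace N)) G) :=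
        fun G hG => ProbabilityMeasure.le_liminf_measure_open_of_tendsto hlim hG
      have h1 := lintegral_le_liminf_lintegral_of_forall_isOpen_measure_le_liminf_measure
        (μ := (ν : Measure (PhaseSpace N)))
        (μs := fun n => ((pm (s n) : ProbabilityMeasure (PhaseSpace N)) : Measure (PhaseSpace N)))
        (f := V) hVc (fun x => (Real.exp_pos _).le) hopen
      have h2 : atTop.liminf (fun n => ∫⁻ x, ENNReal.ofReal (V x)
          ∂((pm (s n) : ProbabilityMeasure (PhaseSpace N)) : Measure (PhaseSpace N))) ≤ ENNReal.ofReal M := by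
        refine liminf_le_of_frequently_le' (hsT.mono fun n hn => ?_).frequently
        rw [hpm _ hn]
        obtain ⟨hint, hle⟩ := hM _ hn
        rw [← ofReal_integral_eq_lintegral_ofReal hint (Eventually.of_forall fun x => (Real.exp_pos _).le)]
        exact ENNReal.ofReal_le_ofReal hle
      refine ⟨hVc.aestronglyMeasurable, ?_⟩
      show ∫⁻ x, ‖V x‖ₑ ∂(ν : Measure (PhaseSpace N)) < (⊤ : ℝ≥0∞)
      have h3 : ∫⁻ x, ‖V x‖ₑ ∂(ν : Measure (PhaseSpace N)) = ∫⁻ x, ENNReal.ofReal (V x) ∂(ν : Measure (PhaseSpace N)) :=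
        lintegral_congr fun x => Real.enorm_eq_ofReal (Real.exp_pos _).le
      rw [h3]
      exact lt_of_le_of_lt (h1.trans h2) ENNReal.ofReal_lt_top
    have hνss : P.IsFlipSteadyState N T T ε (ν : Measure (PhaseSpace N)) :=
      ⟨inferInstance, hgen, fun i =>
        pinnedChain_integrable_bondCurrent_of_integrable_exp hω.le hl.le hβ.le γ N hϑ0 hintV i⟩
    exact (hμ N T T hT hT).2 _ hνss
  ----------------------------------------------------------------
  -- conclusion: every sequence has a subsequence along which the integrals converge
  ----------------------------------------------------------------
  refine tendsto_of_subseq_tendsto fun ns hns => ?_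
  have hns0 : Tendsto ns atTop (𝓝 0) := hns.mono_right nhdsWithin_le_nhds
  have hnsT : ∀ᶠ n in atTop, |ns n| ≤ T := by
    have h : ∀ᶠ δ : ℝ in 𝓝 0, |δ| ≤ T := by
      have : Metric.closedBall (0 : ℝ) T ∈ 𝓝 (0 : ℝ) := Metric.closedBall_mem_nhds 0 hT
      filter_upwards [this] with δ hδ
      simpa [Real.dist_eq] using hδ
    exact hns0.eventually h
  have hev : ∀ᶠ n in atTop, pm (ns n) ∈ closure S :=
    hnsT.mono fun n hn => subset_closure (show pm (ns n) ∈ S from ⟨ns n, hn, rfl⟩)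
  have hfreq : ∃ᶠ n in atTop, pm (ns n) ∈ closure S := hev.frequently
  obtain ⟨ν, -, φ, hφ, hlim⟩ := hcomp.tendsto_subseq' hfreq
  have hφT : ∀ᶠ n in atTop, |ns (φ n)| ≤ T := hφ.tendsto_atTop.eventually hnsT
  have hν := hident (ns ∘ φ) (hns0.comp hφ.tendsto_atTop) ν hlim
  refine ⟨φ, ?_⟩
  have hgC' : ∀ x, ‖g x‖ ≤ C := fun x => by rw [Real.norm_eq_abs]; exact hgC x
  let gb : PhaseSpace N →ᵇ ℝ := BoundedContinuousFunction.ofNormedAddCommGroup g hg C hgC'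
  have hwk := (ProbabilityMeasure.tendsto_iff_forall_integral_tendsto.1 hlim) gb
  rw [hν] at hwk
  refine hwk.congr' ?_
  filter_upwards [hφT] with n hn
  change ∫ x, g x ∂((pm (ns (φ n)) : ProbabilityMeasure (PhaseSpace N)) : Measure (PhaseSpace N)) = _
  rw [hpm _ hn]

/-- **Weak continuity of the unique flip-steady family at `δ = 0` on exponentially dominated observables**,
GIVEN uniform exponential moments on `|δ| ≤ T`: for continuous `g` with `|g| ≤ C e^{ϑ'H}`, `0 ≤ ϑ' < 1/(2T)`, `g` is
integrable under every `μ_{N,T+δ/2,T−δ/2}`, `|δ| ≤ T`, and `∫ g dμ_{N,T+δ/2,T−δ/2} → ∫ g dμ_{N,T,T}` as `δ → 0`,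
`δ ≠ 0` (`flip_tendsto_integral` + `tendsto_integral_of_dominated_growth`). [folklore] -/
theorem flip_tendsto_integral_of_growth (hω : 0 < ω₂) (hl : 0 < lam) (hβ : 0 < β) (ε : ℝ)
    (μ : (N : ℕ) → ℝ → ℝ → Measure (PhaseSpace N))
    (hμ : ∀ (N : ℕ) (T_L T_R : ℝ), 0 < T_L → 0 < T_R →
      (pinnedChain ω₂ lam β γ).IsFlipSteadyState N T_L T_R ε (μ N T_L T_R) ∧
        ∀ ν : Measure (PhaseSpace N), (pinnedChain ω₂ lam β γ).IsFlipSteadyState N T_L T_R ε ν → ν = μ N T_L T_R)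
    {T : ℝ} (hT : 0 < T) {N : ℕ} {M : ℝ}
    (hM : ∀ δ : ℝ, |δ| ≤ T →
      Integrable (fun x => Real.exp (1 / (2 * T) * (pinnedChain ω₂ lam β γ).hamiltonian N x))
          (μ N (T + δ / 2) (T - δ / 2)) ∧
        ∫ x, Real.exp (1 / (2 * T) * (pinnedChain ω₂ lam β γ).hamiltonian N x) ∂(μ N (T + δ / 2) (T - δ / 2)) ≤ M)
    {g : PhaseSpace N → ℝ} (hg : Continuous g) {C ϑ' : ℝ} (hϑ'0 : 0 ≤ ϑ') (hϑ'1 : ϑ' < 1 / (2 * T))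
    (hgC : ∀ x, |g x| ≤ C * Real.exp (ϑ' * (pinnedChain ω₂ lam β γ).hamiltonian N x)) :
    (∀ δ : ℝ, |δ| ≤ T → Integrable g (μ N (T + δ / 2) (T - δ / 2))) ∧
      Tendsto (fun δ : ℝ => ∫ x, g x ∂(μ N (T + δ / 2) (T - δ / 2))) (𝓝[≠] 0)
        (𝓝 (∫ x, g x ∂(μ N T T))) := by
  have hM0 := hM 0 (by simpa using hT.le)
  simp only [zero_div, add_zero, sub_zero] at hM0
  exact tendsto_integral_of_dominated_growth (fun δ => μ N (T + δ / 2) (T - δ / 2)) (μ N T T)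
    (pinnedChain_continuous_hamiltonian ω₂ lam β γ N)
    (fun x => pinnedChain_hamiltonian_nonneg hω.le hl.le hβ.le γ N x) hϑ'0 hϑ'1 hT hM hM0
    (fun g hg C hgC => flip_tendsto_integral hω hl hβ ε μ hμ hT hM hg hgC) hg hgC

end Weak

/-! ## Registered helper -/

/-- Registered helper sub-goal `helper_flipNessTendstoIntegral` of stub `stub_noisyPositiveConductance` (line
`fekete-usc-one-length`, crux stmt-AtomisticToContinuum-11976): the unique flip-steady family is weakly continuous
at `δ = 0` on exponentially dominated continuous observables, given uniform exponential moments
(`flip_tendsto_integral_of_growth`). -/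
theorem helper_flipNessTendstoIntegral : ∀ (ω₂ lam β γ : ℝ), 0 < ω₂ → 0 < lam → 0 < β → 0 < γ → ∀ (ε : ℝ) (μ : (N : ℕ) → ℝ → ℝ → MeasureTheory.Measure (Literature.MathematicalPhysics.KineticTheory.HeatConduction.PhaseSpace N)), (∀ (N : ℕ) (T_L T_R : ℝ), 0 < T_L → 0 < T_R → (Literature.MathematicalPhysics.KineticTheory.HeatConduction.pinnedChain ω₂ lam β γ).IsFlipSteadyState N T_L T_R ε (μ N T_L T_R) ∧ ∀ ν : MeasureTheory.Measure (Literature.MathematicalPhysics.KineticTheory.HeatConduction.PhaseSpace N), (Literature.MathematicalPhysics.KineticTheory.HeatConduction.pinnedChain ω₂ lam β γ).IsFlipSteadyState N T_L T_R ε ν → ν = μ N T_L T_R) → ∀ (T : ℝ), 0 < T → ∀ (N : ℕ) (M : ℝ), (∀ δ : ℝ, |δ| ≤ T → MeasureTheory.Integrable (fun x => Real.exp (1 / (2 * T) * (Literature.MathematicalPhysics.KineticTheory.HeatConduction.pinnedChain ω₂ lam β γ).hamiltonian N x)) (μ N (T + δ / 2) (T - δ / 2)) ∧ MeasureTheory.integral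 (μ N (T + δ / 2) (T - δ / 2)) (fun x => Real.exp (1 / (2 * T) * (Literature.MathematicalPhysics.KineticTheory.HeatConduction.pinnedChain ω₂ lam β γ).hamiltonian N x)) ≤ M) → ∀ (g : Literature.MathematicalPhysics.KineticTheory.HeatConduction.PhaseSpace N → ℝ), Continuous g → ∀ (C ϑ' : ℝ), 0 ≤ ϑ' → ϑ' < 1 / (2 * T) → (∀ x, |g x| ≤ C * Real.exp (ϑ' * (Literature.MathematicalPhysics.KineticTheory.HeatConduction.pinnedChain ω₂ lam β γ).hamiltonian N x)) → (∀ δ : ℝ, |δ| ≤ T → MeasureTheory.Integrable g (μ N (T + δ / 2) (T - δ / 2))) ∧ Filter.Tendsto (fun δ : ℝ => MeasureTheory.integral (μ N (T + δ / 2) (T - δ / 2)) (fun x => g x)) (nhdsWithin 0 {(0 : ℝ)}ᶜ) (nhds (MeasureTheory.integral (μ N T T) (fun x => g x))) :=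
  fun _ _ _ _ hω hl hβ _ ε μ hμ _ hT _ _ hM _ hg _ _ hϑ'0 hϑ'1 hgC =>
    flip_tendsto_integral_of_growth hω hl hβ ε μ hμ hT hM hg hϑ'0 hϑ'1 hgC

end Summit.AtomisticToContinuum.FouriersLaw.Theorems.VanishingNoiseBound

end
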